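import Summits.HodgeConjecture.HodgeConjecture.Theorems.Ring2WeilCoverageRealUnitNormAllLevels
import HarnessLib

/-!
# Weil-type family coverage — THEOREM L (i) OUTSIDE THE EXCEPTIONAL SET `{2^a, p^a, 2p^a}`, and in signature form:
# every real unit of `ℤ[ζₙ]` is negative at an EVEN number of places of every CM type

research route conditional on HC_CM; not a corollary; Q11.4-sentence-2 already refuted in dim ≥ 3.

Ring 2, WEIL-TYPE FAMILY-COVERAGE CENSUS (`HOME/WEIL-FAMILY-COVERAGE.md` `## b01`, block b01.44; owner ring2-b01), part 68
of the `Ring2WeilCoverage*` series — two reformulations of part 67's THEOREM L (i) at every level.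

* §1 `exists_oddPrime_dvd_two_lt_ordCompl` — elementary: a positive integer that is not a power of `2`, not an odd prime
  power and not twice an odd prime power has an odd prime divisor `q` with `n / q^{v_q(n)} ≥ 3`; hence
  **`norm_realUnits_pos_of_not_exceptional`: for `n ∉ {2^a, p^a, 2p^a}` every unit of `ℚ(ζₙ)⁺` has positive norm**
  — THEOREM L (i) with the exceptional set spelled out (part 67 `norm_realUnits_pos_of_dvd`).
* §2 **`even_ncard_re_neg_of_units`** — the signature form used by the census (parts 2/16/22/23/55): at a level
  `n = n₀·q^b` (`q` odd prime, `b ≥ 1`, `(n₀, q) = 1`, `n₀ ≥ 3`), for EVERY CM type `Φ` of `K = ℚ(ζₙ)` and every unit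
  `u` of `𝓞 K` fixed by complex conjugation, `#{φ ∈ Φ : Re φ(u) < 0}` is EVEN (Mathlib
  `IsCMField.Units.complexConj_eq_self_iff` descends `u` to a unit of `𝓞 K⁺`; part 55 `norm_pos_iff_even_ncard` reads
  the sign of its norm on `Φ`) — i.e. the signature group of the real units lies in the even hyperplane of `{±1}^Φ`;
  THEOREM L (ii), where available, says it IS the even hyperplane.

HONEST FRAMING: elementary number theory; nothing here is a statement about Hodge classes, `W_K`, general members or HC;
`HC_CM` is used nowhere.  No `def`, no named fact, no `sorry`.

References: [cite: Washington1997, §2, Prop. 2.16]; [cite: Garbanati1976UnitsNormMinusOne] (background); census b01.44.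
-/

noncomputable section

open scoped Classical NumberField
open NumberField Module

namespace Summit.HodgeConjecture.Ring2WeilCoverage.RealUnitNormNonExceptional

open Literature.AlgebraicGeometry.Motives (CMType)
open Summit.HodgeConjecture.Ring2WeilCoverage.RealUnitNormAllLevels (norm_realUnits_pos norm_realUnits_pos_of_dvd)
open Summit.HodgeConjecture.Ring2WeilCoverage.TypeNormSign (norm_pos_iff_even_ncard)

/-! ### §1 The exceptional set `{2^a, p^a, 2p^a}` -/

/-- **Outside `{2^a, p^a, 2p^a}` there is an odd prime `q ∣ n` with `n / q^{v_q(n)} ≥ 3`.**  (`n ≠ 0`; the odd part of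
`n` is `> 1`, so it has an odd prime factor `q`; the prime-to-`q` part of `n` is neither `1` nor `2`.)
research route conditional on HC_CM; not a corollary; Q11.4-sentence-2 already refuted in dim ≥ 3. [folklore] -/
theorem exists_oddPrime_dvd_two_lt_ordCompl {n : ℕ} (hn : n ≠ 0) (h2 : ∀ a : ℕ, n ≠ 2 ^ a)
    (hp : ∀ p a : ℕ, p.Prime → p ≠ 2 → n ≠ p ^ a ∧ n ≠ 2 * p ^ a) :
    ∃ q : ℕ, q.Prime ∧ q ≠ 2 ∧ q ∣ n ∧ 2 < n / q ^ n.factorization q := by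
  -- the odd part `m` of `n` is `> 1`
  have hkey2 := Nat.ordProj_mul_ordCompl_eq_self n 2
  have hcop2 : Nat.Coprime 2 (n / 2 ^ n.factorization 2) := Nat.coprime_ordCompl Nat.prime_two hn
  have hm1 : n / 2 ^ n.factorization 2 ≠ 1 := by
    intro h1
    rw [h1, mul_one] at hkey2
    exact h2 _ hkey2.symm
  obtain ⟨q, hq, hqm⟩ := Nat.exists_prime_and_dvd hm1
  have hq2 : q ≠ 2 := by
    rintro rfl
    exact absurd (Nat.Coprime.eq_one_of_dvd hcop2 hqm) (by norm_num)
  have hqn : q ∣ n := hqm.trans (Nat.ordCompl_dvd n 2)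
  refine ⟨q, hq, hq2, hqn, ?_⟩
  -- the prime-to-`q` part `m'` of `n` is `≥ 3`
  have hkey := Nat.ordProj_mul_ordCompl_eq_self n q
  have hm'0 : 0 < n / q ^ n.factorization q := Nat.ordCompl_pos q hn
  by_contra hle
  push Not at hle
  obtain ⟨h1, h2'⟩ := hp q (n.factorization q) hq hq2
  interval_cases h : n / q ^ n.factorization q
  · rw [mul_one] at hkey; exact h1 hkey.symm
  · rw [mul_comm] at hkey; exact h2' hkey.symm

variable {K : Type} [Field K] [NumberField K] [IsCMField K] {n : ℕ} [NeZero n] {ζ : K}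

/-- **THEOREM L (i) OUTSIDE `{2^a, p^a, 2p^a}`.**  If `n` is not a power of `2`, not an odd prime power and not twice an
odd prime power, then every unit of `ℚ(ζₙ)⁺` has positive norm (part 67 at the odd prime of §1).
research route conditional on HC_CM; not a corollary; Q11.4-sentence-2 already refuted in dim ≥ 3. [cite: Washington1997, §2, Prop. 2.16] -/
theorem norm_realUnits_pos_of_not_exceptional [IsCyclotomicExtension {n} ℚ K] (hζ : IsPrimitiveRoot ζ n)
    (h2 : ∀ a : ℕ, n ≠ 2 ^ a) (hp : ∀ p a : ℕ, p.Prime → p ≠ 2 → n ≠ p ^ a ∧ n ≠ 2 * p ^ a)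
    (v : (𝓞 (maximalRealSubfield K))ˣ) :
    0 < Algebra.norm ℚ (((v : 𝓞 (maximalRealSubfield K)) : maximalRealSubfield K)) := by
  obtain ⟨q, hq, hq2, hqn, h3⟩ := exists_oddPrime_dvd_two_lt_ordCompl (NeZero.ne n) h2 hp
  exact norm_realUnits_pos_of_dvd hζ hq hq2 hqn h3 v

/-! ### §2 Signature form: real units are negative at an even number of places of every CM type -/

/-- **EVEN SIGNATURES.**  At a level `n = n₀·q^b` (`q` odd prime, `b ≥ 1`, `(n₀, q) = 1`, `n₀ ≥ 3`), for every CM type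
`Φ` of `K = ℚ(ζₙ)` and every unit `u` of `𝓞 K` with `u^ρ = u`: **`#{φ ∈ Φ : Re φ(u) < 0}` is even** — the unit `u`
is a unit `v` of `𝓞 K⁺`, whose norm is positive by part 67 and is read on `Φ` by part 55.
research route conditional on HC_CM; not a corollary; Q11.4-sentence-2 already refuted in dim ≥ 3. [cite: Washington1997, §2, Prop. 2.16] -/
theorem even_ncard_re_neg_of_units [IsCyclotomicExtension {n} ℚ K] (hζ : IsPrimitiveRoot ζ n) {n₀ q b : ℕ}
    (hq : q.Prime) (hq2 : q ≠ 2) (hn : n = n₀ * q ^ b) (hb : b ≠ 0) (hcop : n₀.Coprime q) (hn₀ : 2 < n₀)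
    (Φ : CMType K) (u : (𝓞 K)ˣ)
    (hu : IsCMField.complexConj K ((u : 𝓞 K) : K) = ((u : 𝓞 K) : K)) :
    Even ((Φ.1 ∩ {ψ : K →+* ℂ | (ψ ((u : 𝓞 K) : K)).re < 0}).ncard) := by
  obtain ⟨v, hv⟩ := (IsCMField.Units.complexConj_eq_self_iff K u).mp hu
  have hpos := norm_realUnits_pos hζ hq hq2 hn hb hcop hn₀ v
  have heven := (norm_pos_iff_even_ncard Φ (v.ne_zero)).mp hpos
  have hv' : algebraMap (𝓞 (maximalRealSubfield K)) K (v : 𝓞 (maximalRealSubfield K)) = ((u : 𝓞 K) : K) := hv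
  rwa [hv'] at heven

/-- **No odd signature** (contrapositive form used by part 60): at such a level there is NO real unit of `𝓞 K` negative
at an odd number of places of a CM type `Φ`.
research route conditional on HC_CM; not a corollary; Q11.4-sentence-2 already refuted in dim ≥ 3. [cite: Washington1997, §2, Prop. 2.16] -/
theorem not_odd_ncard_re_neg_of_units [IsCyclotomicExtension {n} ℚ K] (hζ : IsPrimitiveRoot ζ n) {n₀ q b : ℕ}
    (hq : q.Prime) (hq2 : q ≠ 2) (hn : n = n₀ * q ^ b) (hb : b ≠ 0) (hcop : n₀.Coprime q) (hn₀ : 2 < n₀)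
    (Φ : CMType K) (u : (𝓞 K)ˣ)
    (hu : IsCMField.complexConj K ((u : 𝓞 K) : K) = ((u : 𝓞 K) : K)) :
    ¬ Odd ((Φ.1 ∩ {ψ : K →+* ℂ | (ψ ((u : 𝓞 K) : K)).re < 0}).ncard) :=
  Nat.not_odd_iff_even.mpr (even_ncard_re_neg_of_units hζ hq hq2 hn hb hcop hn₀ Φ u hu)

end Summit.HodgeConjecture.Ring2WeilCoverage.RealUnitNormNonExceptional

end
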